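/-
Copyright: the b2b-balaban T⁴-continuum CRUX team, row NE7b OWNER lineage `t4-ne7b-p1` (gen 142). Project licence.
-/
import Summits.QuantumFields.BalabanUV.T4Continuum.Spine.NE7b.SupKernelSchurTrilinear
import Summits.QuantumFields.BalabanUV.T4Continuum.Spine.NE7b.SupWhitenedFourthTwoPointEntries

/-!
# THE OPERATOR LETTER OF A QUADRILINEAR KERNEL FROM TWO SLOT LETTERS (Schur at order 4; the order-4 block of the kernel-letter CLASS MAP,
# sixth file).  (481) read the operator norm of a trilinear map on `ℝ^ι` off two fixed-slot letters by a weighted Cauchy–Schwarz; the same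
# device one order up: for a continuous `4`-linear map `Q` with entries `Q_{xyzt} = Q[e_x,e_y,e_z,e_t]`, the slot-3 letter
# `Σ_{x,y,t}|Q_{xyzt}| ≤ L₃` (all `z`) and the slot-4 letter `Σ_{x,y,z}|Q_{xyzt}| ≤ L₄` (all `t`) give
#   `|Q[φ,h,k,m]| ≤ √(L₃L₄)·‖φ‖·‖h‖·‖k‖·‖m‖`,   hence   `‖Q‖ ≤ √(L₃L₄)`
# (the first two slots by `|φ_x| ≤ ‖φ‖`, `|h_y| ≤ ‖h‖`; the last two by (481)'s weighted Cauchy–Schwarz with `S_{zt} = Σ_{x,y}|Q_{xyzt}|`).  With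
# (528)∕(529)'s four letters of the output majorant this is how the operator letter `κ₄⁺` of the next step is READ OFF — once the fourth
# derivative of the next potential is packaged as a `4`-linear map (the `C⁴` repackaging, successor) (row NE7b, node U5c; (481)
# `weighted_cauchy_schwarz`, `trilinear_expand`, (501) `expand_first_slot_four` BY NAME; [folklore])

Cell `pub-balaban`, sub-cell `t4`, spine estimate NE7b (`T4WeightBudget.RelWeightBound`; the cell's OWN estimate — NOT PRINTED in
[Bałaban 1983–89], NOT PROVED).  Crux-route work under `Spine/NE7b/` by the row OWNER (`t4-ne7b-p1` gen 142, file (530)) under FREEZE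
(0)'s crux-prover clause; NOTHING of Bałaban's is named as a Lean object, valued or asserted; no `T4Continuum/Support` leaf typed; no
`def`, no notation; zero `sorry`.  Imports (BY NAME): the OWNER's (481) `…SupKernelSchurTrilinear` (`weighted_cauchy_schwarz`, `trilinear_expand`),
(501) `…SupWhitenedFourthTwoPointEntries` (`expand_first_slot_four`).

WHAT IS PROVED ([folklore]): §1 `quadrilinear_kernel_sum_le`; §2 `quadrilinear_expand`, THE END **`opNorm_le_of_slot_letters_four`**; §3 toy.

HONEST (what this is NOT).  A finite-dimensional inequality; its application to `∂⁴W` needs the `C⁴` repackaging of (521)'s directional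
derivative as a `4`-linear map (NOT typed); scalar skeleton ((A3), NC-NE7b-α UNRULED); nothing of Bałaban's asserted.  BY-NAME EFFECT ON THE
WALL: NONE.  NE7b NOT PRINTED ∕ NOT PROVED; spine PROVED 0∕9; rung (B)+1 — the programme's measures remain FINITE-torus statements; NOT the mass
gap, NOT Clay.  HONEST DEPENDENCY: continuum YM on T⁴ ⇐ BetaPertH ∧ nine spine estimates (0∕9 proved); BetaPertH ⇐ (D1) ∧ (D4) ∧ CAP+tail;
G-an2-4 gates asym, D1 and NE2∕3∕4.
-/

set_option autoImplicit false
set_option maxSynthPendingDepth 3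

noncomputable section

namespace Summit.QuantumFields.BalabanUV.T4Continuum.NE7b.SupKernelSchurQuadrilinear

open Real Finset
open scoped BigOperators
open SupKernelSchurTrilinear (weighted_cauchy_schwarz trilinear_expand)
open SupWhitenedFourthTwoPointEntries (expand_first_slot_four)

variable {ι : Type} [Fintype ι]

/-! ## §1. Scalar quadrilinear kernels -/

/-- **A quadrilinear kernel sum is bounded by two slot letters**: `Σ_{x,y,t}|Q_{xyzt}| ≤ L₃` (all `z`), `Σ_{x,y,z}|Q_{xyzt}| ≤ L₄` (all `t`)
give `|Σ_{x,y,z,t}φ_xh_yk_zm_tQ_{xyzt}| ≤ √(L₃L₄)·‖φ‖·‖h‖·‖k‖·‖m‖`. [folklore] -/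
theorem quadrilinear_kernel_sum_le (Q₄ : ι → ι → ι → ι → ℝ) {L₃ L₄ : ℝ} (hs3 : ∀ z, ∑ x, ∑ y, ∑ t, |Q₄ x y z t| ≤ L₃)
    (hs4 : ∀ t, ∑ x, ∑ y, ∑ z, |Q₄ x y z t| ≤ L₄) (φ h k m : EuclideanSpace ℝ ι) :
    |∑ x, ∑ y, ∑ z, ∑ t, φ x * h y * k z * m t * Q₄ x y z t| ≤ Real.sqrt (L₃ * L₄) * ‖φ‖ * ‖h‖ * ‖k‖ * ‖m‖ := by
  have hφ : ∀ x, |φ x| ≤ ‖φ‖ := fun x => by rw [← Real.norm_eq_abs]; exact PiLp.norm_apply_le φ x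
  have hh : ∀ y, |h y| ≤ ‖h‖ := fun y => by rw [← Real.norm_eq_abs]; exact PiLp.norm_apply_le h y
  -- the triangle inequality and the first two slots
  have h1 : |∑ x, ∑ y, ∑ z, ∑ t, φ x * h y * k z * m t * Q₄ x y z t| ≤ ∑ x, ∑ y, ∑ z, ∑ t, ‖φ‖ * ‖h‖ * (|Q₄ x y z t| * |k z| * |m t|) := by
    refine (Finset.abs_sum_le_sum_abs _ _).trans (Finset.sum_le_sum fun x _ => ?_)
    refine (Finset.abs_sum_le_sum_abs _ _).trans (Finset.sum_le_sum fun y _ => ?_)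
    refine (Finset.abs_sum_le_sum_abs _ _).trans (Finset.sum_le_sum fun z _ => ?_)
    refine (Finset.abs_sum_le_sum_abs _ _).trans (Finset.sum_le_sum fun t _ => ?_)
    rw [abs_mul, abs_mul, abs_mul, abs_mul]
    have hnn : 0 ≤ |Q₄ x y z t| * |k z| * |m t| := by positivity
    calc |φ x| * |h y| * |k z| * |m t| * |Q₄ x y z t| = |φ x| * |h y| * (|Q₄ x y z t| * |k z| * |m t|) := by ring
      _ ≤ ‖φ‖ * ‖h‖ * (|Q₄ x y z t| * |k z| * |m t|) :=
          mul_le_mul_of_nonneg_right (mul_le_mul (hφ x) (hh y) (abs_nonneg _) (norm_nonneg _)) hnn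
  -- regroup: the weight `S_{zt} = Σ_xΣ_y|Q_{xyzt}|`; reorder `(x,y,z,t) → (z,t,x,y)`
  have h2 : ∑ x, ∑ y, ∑ z, ∑ t, ‖φ‖ * ‖h‖ * (|Q₄ x y z t| * |k z| * |m t|) =
      ‖φ‖ * ‖h‖ * ∑ z, ∑ t, (∑ x, ∑ y, |Q₄ x y z t|) * |k z| * |m t| := by
    have e1 : ∀ z t, (∑ x, ∑ y, |Q₄ x y z t|) * |k z| * |m t| = ∑ x, ∑ y, |Q₄ x y z t| * |k z| * |m t| := fun z t => by
      rw [Finset.sum_mul, Finset.sum_mul]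
      refine Finset.sum_congr rfl fun x _ => ?_
      rw [Finset.sum_mul, Finset.sum_mul]
    simp_rw [e1]
    simp only [Finset.mul_sum]
    calc ∑ x, ∑ y, ∑ z, ∑ t, ‖φ‖ * ‖h‖ * (|Q₄ x y z t| * |k z| * |m t|)
        = ∑ x, ∑ z, ∑ y, ∑ t, ‖φ‖ * ‖h‖ * (|Q₄ x y z t| * |k z| * |m t|) := Finset.sum_congr rfl fun x _ => Finset.sum_comm
      _ = ∑ z, ∑ x, ∑ y, ∑ t, ‖φ‖ * ‖h‖ * (|Q₄ x y z t| * |k z| * |m t|) := Finset.sum_comm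
      _ = ∑ z, ∑ x, ∑ t, ∑ y, ‖φ‖ * ‖h‖ * (|Q₄ x y z t| * |k z| * |m t|) :=
          Finset.sum_congr rfl fun z _ => Finset.sum_congr rfl fun x _ => Finset.sum_comm
      _ = ∑ z, ∑ t, ∑ x, ∑ y, ‖φ‖ * ‖h‖ * (|Q₄ x y z t| * |k z| * |m t|) := Finset.sum_congr rfl fun z _ => Finset.sum_comm
  have hrow : ∀ z, ∑ t, ∑ x, ∑ y, |Q₄ x y z t| ≤ L₃ := fun z => by
    calc ∑ t, ∑ x, ∑ y, |Q₄ x y z t| = ∑ x, ∑ t, ∑ y, |Q₄ x y z t| := Finset.sum_comm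
      _ = ∑ x, ∑ y, ∑ t, |Q₄ x y z t| := Finset.sum_congr rfl fun x _ => Finset.sum_comm
      _ ≤ L₃ := hs3 z
  have hcol : ∀ t, ∑ z, ∑ x, ∑ y, |Q₄ x y z t| ≤ L₄ := fun t => by
    calc ∑ z, ∑ x, ∑ y, |Q₄ x y z t| = ∑ x, ∑ z, ∑ y, |Q₄ x y z t| := Finset.sum_comm
      _ = ∑ x, ∑ y, ∑ z, |Q₄ x y z t| := Finset.sum_congr rfl fun x _ => Finset.sum_comm
      _ ≤ L₄ := hs4 t
  have h3 := weighted_cauchy_schwarz (fun z t => ∑ x, ∑ y, |Q₄ x y z t|)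
    (fun z t => Finset.sum_nonneg fun x _ => Finset.sum_nonneg fun y _ => abs_nonneg _) hrow hcol k m
  rw [h2] at h1
  calc |∑ x, ∑ y, ∑ z, ∑ t, φ x * h y * k z * m t * Q₄ x y z t| ≤ ‖φ‖ * ‖h‖ * ∑ z, ∑ t, (∑ x, ∑ y, |Q₄ x y z t|) * |k z| * |m t| := h1
    _ ≤ ‖φ‖ * ‖h‖ * (Real.sqrt (L₃ * L₄) * ‖k‖ * ‖m‖) := mul_le_mul_of_nonneg_left h3 (mul_nonneg (norm_nonneg _) (norm_nonneg _))
    _ = Real.sqrt (L₃ * L₄) * ‖φ‖ * ‖h‖ * ‖k‖ * ‖m‖ := by ring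

/-! ## §2. THE END: the operator letter of a quadrilinear map from its slot letters -/

section Operator

variable [DecidableEq ι]

/-- **The full coordinate expansion of a quadrilinear map**: `Q[φ,h,k,m] = Σ_xΣ_yΣ_zΣ_t φ_x·h_y·k_z·m_t·Q[e_x,e_y,e_z,e_t]`. [folklore] -/
theorem quadrilinear_expand (Q : EuclideanSpace ℝ ι →L[ℝ] EuclideanSpace ℝ ι →L[ℝ] EuclideanSpace ℝ ι →L[ℝ] EuclideanSpace ℝ ι →L[ℝ] ℝ)
    (φ h k m : EuclideanSpace ℝ ι) :
    Q φ h k m = ∑ x, ∑ y, ∑ z, ∑ t, φ x * h y * k z * m t * Q (EuclideanSpace.single x (1 : ℝ)) (EuclideanSpace.single y (1 : ℝ))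
      (EuclideanSpace.single z (1 : ℝ)) (EuclideanSpace.single t (1 : ℝ)) := by
  rw [expand_first_slot_four Q φ h k m]
  refine Finset.sum_congr rfl fun x _ => ?_
  rw [trilinear_expand (Q (EuclideanSpace.single x (1 : ℝ))) h k m, Finset.mul_sum]
  refine Finset.sum_congr rfl fun y _ => ?_
  rw [Finset.mul_sum]
  refine Finset.sum_congr rfl fun z _ => ?_
  rw [Finset.mul_sum]
  exact Finset.sum_congr rfl fun t _ => by ring

/-- **THE END — SCHUR AT ORDER 4**: a continuous quadrilinear map on `ℝ^ι` whose entries have the slot-3 letter `Σ_{x,y,t}|Q[e_x,e_y,e_z,e_t]| ≤ L₃`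
and the slot-4 letter `Σ_{x,y,z}|Q[e_x,e_y,e_z,e_t]| ≤ L₄` has operator norm `‖Q‖ ≤ √(L₃L₄)`. [folklore] -/
theorem opNorm_le_of_slot_letters_four (Q : EuclideanSpace ℝ ι →L[ℝ] EuclideanSpace ℝ ι →L[ℝ] EuclideanSpace ℝ ι →L[ℝ] EuclideanSpace ℝ ι →L[ℝ] ℝ)
    {L₃ L₄ : ℝ}
    (hs3 : ∀ z, ∑ x, ∑ y, ∑ t, |Q (EuclideanSpace.single x (1 : ℝ)) (EuclideanSpace.single y (1 : ℝ)) (EuclideanSpace.single z (1 : ℝ))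
      (EuclideanSpace.single t (1 : ℝ))| ≤ L₃)
    (hs4 : ∀ t, ∑ x, ∑ y, ∑ z, |Q (EuclideanSpace.single x (1 : ℝ)) (EuclideanSpace.single y (1 : ℝ)) (EuclideanSpace.single z (1 : ℝ))
      (EuclideanSpace.single t (1 : ℝ))| ≤ L₄) :
    ‖Q‖ ≤ Real.sqrt (L₃ * L₄) := by
  have hC : 0 ≤ Real.sqrt (L₃ * L₄) := Real.sqrt_nonneg _
  refine ContinuousLinearMap.opNorm_le_bound _ hC fun φ => ?_
  refine ContinuousLinearMap.opNorm_le_bound _ (mul_nonneg hC (norm_nonneg _)) fun h => ?_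
  refine ContinuousLinearMap.opNorm_le_bound _ (mul_nonneg (mul_nonneg hC (norm_nonneg _)) (norm_nonneg _)) fun k => ?_
  refine ContinuousLinearMap.opNorm_le_bound _ (mul_nonneg (mul_nonneg (mul_nonneg hC (norm_nonneg _)) (norm_nonneg _)) (norm_nonneg _)) fun m => ?_
  rw [Real.norm_eq_abs, quadrilinear_expand Q φ h k m]
  exact quadrilinear_kernel_sum_le (fun x y z t => Q (EuclideanSpace.single x (1 : ℝ)) (EuclideanSpace.single y (1 : ℝ)) (EuclideanSpace.single z (1
      : ℝ))
    (EuclideanSpace.single t (1 : ℝ))) hs3 hs4 φ h k m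

end Operator

/-! ## §3. Toy -/

/-- Toy (§1 in numbers on `Fin 1`, all letters `1`): `|1·1·1·1·1| ≤ √(1·1)·1·1·1·1` reduces to `1 ≤ 1`. -/
example : Real.sqrt (1 * 1) * 1 * 1 * 1 * 1 = (1 : ℝ) := by simp

end Summit.QuantumFields.BalabanUV.T4Continuum.NE7b.SupKernelSchurQuadrilinear

end
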